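import Mathlib.Data.Matrix.PEquiv
import Literature.MathematicalPhysics.QuantumLattice.SpinSystemProofs
import Literature.MathematicalPhysics.QuantumLattice.HeisenbergModelProofs
import Literature.MathematicalPhysics.QuantumLattice.LiebMattisLadder
import Literature.MathematicalPhysics.QuantumLattice.LocalDynamicsSupportedOnProofs
import Literature.MathematicalPhysics.QuantumLattice.HubbardLSMFillingProofs
import Literature.MathematicalPhysics.QuantumLattice.ApproximateEigenvectorLemmas
import HarnessLib

/-!
# Kinematics of spin-`1/2` charge transport: local algebras, lattice relabellings, `U(1)` charges

Generic finite-volume layer (arbitrary finite site set `Λ`, local dimension `q`, resp. `q = 2`) for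
the Lieb–Schultz–Mattis index argument of Bachmann–Bols–De Roeck–Fraas, Comm. Math. Phys. **375**
(2019) 1249 (BBDF), §2.1–2.2 and §3.2, transposed from lattice fermions (the tree's
`HubbardTorusCharges`, `CoordinateSlabs`, `ChargeTransportIndex`) to quantum SPIN systems in the
concrete `ℓ²(Λ → Fin q)` picture of `SpinSystem.lean`. Everything is PROVED (real definitions +
theorems, no named facts):

* `supportedSubalgebra X` — the local algebra `𝔄_X = {A : IsSupportedOn A X}` as a `Subalgebra`
  (BBDF §2.1.2; Bratteli–Robinson II §6.2.1): monotone, `⋆`-closed, elementwise commuting for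
  disjoint regions, containing `onSite x a` (`x ∈ X`) and the local Hamiltonians of local
  interactions;
* `permOp e` — the permutation unitary of a site relabelling `e : Λ ≃ Λ` (`(permOp e ψ)(σ) = ψ(σ ∘ e)`),
  with `permOp e * A * (permOp e)ᴴ = reindexOp e A` (so `permOp e · 𝟙⊗a_x⊗𝟙 · (permOp e)ᴴ = 𝟙⊗a_{e x}⊗𝟙`),
  `(permOp e)ᴴ = permOp e.symm`, unitarity, and covariance of the local algebras
  (`reindexOp_mem_supportedSubalgebra`); this is BBDF's lattice translation `U` when `e` is a
  translation of a torus;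
* the **integer charges of a spin-`1/2` system** (BBDF §2.1.4 with `Q_x = Sᶻ_x + ½ = n_x^↑`,
  spectrum `{0, 1} ⊆ ℤ`): `upCharge x = Sᶻ_x + ½`, `regionCharge X = Σ_{x∈X} Q_x`, diagonal in the
  product basis with entries `#{x ∈ X : σ_x = ↑} ∈ ℕ` (`regionCharge_eq_diagonal`), hence Hermitian,
  pairwise commuting, `‖Q_X‖ ≤ #X`, `e^{2πi Q_X} = 1` (`exp_two_pi_I_smul_regionCharge`), supported on
  `X`, covariant (`reindexOp_regionCharge`), and `Q_X = Sᶻ_X + #X/2` (`regionCharge_eq_totalSpin_add`).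

## References

* S. Bachmann, A. Bols, W. De Roeck, M. Fraas, Comm. Math. Phys. **375** (2019) 1249–1272,
  §2.1.2 (local algebras), §2.1.4 (charges with integer spectrum), §3.2 (translations).
  [BachmannEtAl2019]
* O. Bratteli, D. W. Robinson, *Operator Algebras and Quantum Statistical Mechanics II*, §6.2.1.
* H. Tasaki, *Physics and Mathematics of Quantum Many-Body Systems* (2020), §2.2.
* The tree: `SpinSystem(Proofs)` (`localOp`, `IsSupportedOn.mul_holds`, `commute_of_disjoint_holds`,
  `isSupportedOn_onSite_holds`, `IsSupportedOn.mono_holds`), `HeisenbergModelProofs` (`reindexOp_apply`,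
  `reindexOp_onSite`), `LiebMattisLadder` (`LiebMattis.onSite_diagonal`),
  `LocalDynamicsSupportedOnProofs` (`Interaction.IsLocal.isSupportedOn_localHamiltonian`);
  Mathlib `PEquiv.toMatrix` (permutation matrices), `Matrix.l2_opNorm_diagonal`, `Matrix.exp_diagonal`.
-/

noncomputable section

open Matrix Complex Finset
open scoped Matrix.Norms.L2Operator

namespace Literature.MathematicalPhysics.QuantumLattice

/-! ### The local algebras `𝔄_X` as subalgebras -/

section LocalAlgebra

variable {Λ : Type*} [Fintype Λ] [DecidableEq Λ] {q : ℕ}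

/-- **The local algebra `𝔄_X ⊆ 𝔄_Λ`** of observables supported on the region `X` (of the form
`A_X ⊗ 𝟙_{Λ∖X}`), as a subalgebra of the matrix algebra. BBDF (2019) §2.1.2; Bratteli–Robinson II
§6.2.1. [cite: BachmannEtAl2019, §2.1.2] -/
def supportedSubalgebra (X : Finset Λ) : Subalgebra ℂ (Op Λ q) where
  carrier := {A | IsSupportedOn A X}
  mul_mem' hA hB := IsSupportedOn.mul_holds hA hB
  add_mem' hA hB := hA.add hB
  algebraMap_mem' c := by
    rw [Algebra.algebraMap_eq_smul_one]
    exact (IsSupportedOn.one X).smul c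

/-- Membership in `𝔄_X` is `IsSupportedOn`. [folklore] -/
@[simp] theorem mem_supportedSubalgebra {X : Finset Λ} {A : Op Λ q} :
    A ∈ supportedSubalgebra X ↔ IsSupportedOn A X := Iff.rfl

/-- Isotony `X ⊆ Y ⟹ 𝔄_X ≤ 𝔄_Y`. Bratteli–Robinson II §6.2.1. [folklore] -/
theorem supportedSubalgebra_mono {X Y : Finset Λ} (h : X ⊆ Y) :
    (supportedSubalgebra X : Subalgebra ℂ (Op Λ q)) ≤ supportedSubalgebra Y :=
  fun _ hA => IsSupportedOn.mono_holds hA h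

/-- `𝔄_X` is closed under the adjoint. Bratteli–Robinson II §6.2.1. [folklore] -/
theorem conjTranspose_mem_supportedSubalgebra {X : Finset Λ} {A : Op Λ q}
    (hA : A ∈ supportedSubalgebra X) : Aᴴ ∈ supportedSubalgebra X :=
  IsSupportedOn.star hA

/-- **Locality**: `𝔄_X` and `𝔄_Y` commute elementwise for disjoint `X`, `Y`. BBDF (2019) §2.1.2;
Bratteli–Robinson II §6.2.1. [folklore] -/
theorem commute_of_mem_supportedSubalgebra {X Y : Finset Λ} (hXY : Disjoint X Y) {A B : Op Λ q}
    (hA : A ∈ supportedSubalgebra X) (hB : B ∈ supportedSubalgebra Y) : Commute A B :=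
  commute_of_disjoint_holds hA hB hXY

/-- A single-site operator at `x ∈ X` lies in `𝔄_X`. Tasaki (2020) §2.2. [folklore] -/
theorem onSite_mem_supportedSubalgebra {X : Finset Λ} {x : Λ} (hx : x ∈ X)
    (a : Matrix (Fin q) (Fin q) ℂ) : (onSite x a : Op Λ q) ∈ supportedSubalgebra X :=
  IsSupportedOn.mono_holds (isSupportedOn_onSite_holds x a) (Finset.singleton_subset_iff.2 hx)

/-- The local Hamiltonian `H_Z = Σ_{X ⊆ Z} Φ X` of a local interaction lies in `𝔄_Z`.
Nachtergaele–Sims (2006) §2. [folklore] -/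
theorem localHamiltonian_mem_supportedSubalgebra {Φ : Interaction Λ q} (hΦ : Φ.IsLocal)
    (Z : Finset Λ) : localHamiltonian Φ Z ∈ supportedSubalgebra Z :=
  hΦ.isSupportedOn_localHamiltonian Z

/-- A sum of terms of a local interaction over regions contained in `Z` lies in `𝔄_Z`.
Nachtergaele–Sims (2006) §2. [folklore] -/
theorem sum_mem_supportedSubalgebra_of_subset {Φ : Interaction Λ q} (hΦ : Φ.IsLocal)
    {S : Finset (Finset Λ)} {Z : Finset Λ} (hS : ∀ X ∈ S, X ⊆ Z) :
    ∑ X ∈ S, Φ X ∈ supportedSubalgebra Z :=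
  Subalgebra.sum_mem _ fun X hX => IsSupportedOn.mono_holds (hΦ.isSupportedOn X) (hS X hX)

end LocalAlgebra

/-! ### Permutation unitaries of site relabellings -/

section Perm

variable {Λ : Type*} [Fintype Λ] [DecidableEq Λ] {q : ℕ}

/-- The permutation of configurations `σ ↦ σ ∘ e` induced by a site relabelling `e : Λ ≃ Λ`.
[folklore] -/
def configPerm (e : Λ ≃ Λ) : Equiv.Perm (TensorIndex Λ q) :=
  (Equiv.arrowCongr e (Equiv.refl (Fin q))).symm

omit [Fintype Λ] [DecidableEq Λ] in
/-- `configPerm e σ = σ ∘ e`. [folklore] -/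
@[simp] theorem configPerm_apply (e : Λ ≃ Λ) (σ : TensorIndex Λ q) :
    configPerm e σ = fun x => σ (e x) := by
  funext x
  simp [configPerm, Equiv.arrowCongr]

omit [Fintype Λ] [DecidableEq Λ] in
/-- `(configPerm e)⁻¹ = configPerm e⁻¹`. [folklore] -/
theorem configPerm_symm (e : Λ ≃ Λ) : (configPerm (q := q) e).symm = configPerm e.symm := by
  ext σ x
  simp [configPerm, Equiv.arrowCongr]

/-- **The permutation unitary of a site relabelling** `e : Λ ≃ Λ`: `(permOp e ψ)(σ) = ψ(σ ∘ e)`,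
i.e. the permutation matrix of `configPerm e` on the product basis. For a translation `e` of a
torus this is the lattice translation operator (BBDF's `U` of §3.2, Example 2).
Bratteli–Robinson II §6.2.1 (covariance). [cite: BachmannEtAl2019, §3.2] -/
def permOp (e : Λ ≃ Λ) : Op Λ q := ((configPerm e).toPEquiv).toMatrix

/-- Action on vectors: `(permOp e ψ)(σ) = ψ(σ ∘ e)`. [folklore] -/
theorem permOp_mulVec (e : Λ ≃ Λ) (ψ : TensorIndex Λ q → ℂ) :
    permOp e *ᵥ ψ = fun σ => ψ (fun x => σ (e x)) := by
  rw [permOp, PEquiv.toMatrix_toPEquiv_mulVec]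
  funext σ
  simp

omit [DecidableEq Λ] in
/-- Entries of `permOp e`: `⟨σ| permOp e |τ⟩ = [τ = σ ∘ e]`. [folklore] -/
theorem permOp_apply (e : Λ ≃ Λ) (σ τ : TensorIndex Λ q) :
    permOp e σ τ = if τ = (fun x => σ (e x)) then 1 else 0 := by
  rw [permOp, PEquiv.toMatrix_toPEquiv_apply, Pi.single_apply, configPerm_apply]

omit [DecidableEq Λ] in
/-- `(permOp e)ᴴ = permOp e⁻¹` (a real permutation matrix). [folklore] -/
theorem conjTranspose_permOp (e : Λ ≃ Λ) : (permOp e : Op Λ q)ᴴ = permOp e.symm := by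
  ext σ τ
  simp only [conjTranspose_apply, permOp_apply]
  by_cases h : σ = fun x => τ (e x)
  · have h' : τ = fun x => σ (e.symm x) := by
      funext x; rw [h]; simp
    rw [if_pos h, if_pos h', star_one]
  · have h' : ¬ (τ = fun x => σ (e.symm x)) := fun h' => h (by funext x; rw [h']; simp)
    rw [if_neg h, if_neg h', star_zero]

/-- Left multiplication by `permOp e` permutes rows: `permOp e * A = A.submatrix (configPerm e) id`.
[folklore] -/
theorem permOp_mul (e : Λ ≃ Λ) (A : Op Λ q) :
    permOp e * A = A.submatrix (configPerm e) id :=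
  PEquiv.toMatrix_toPEquiv_mul _ _

/-- Right multiplication by `(permOp e)ᴴ` permutes columns:
`A * (permOp e)ᴴ = A.submatrix id (configPerm e)`. [folklore] -/
theorem mul_conjTranspose_permOp (e : Λ ≃ Λ) (A : Op Λ q) :
    A * (permOp e)ᴴ = A.submatrix id (configPerm e) := by
  rw [conjTranspose_permOp, permOp, PEquiv.mul_toMatrix_toPEquiv, configPerm_symm]
  rfl

/-- **Conjugation by the permutation unitary is the relabelling of observables**:
`permOp e * A * (permOp e)ᴴ = reindexOp e A`. Bratteli–Robinson II §6.2.1 (covariance of the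
local structure). [folklore] -/
theorem permOp_mul_mul_conjTranspose (e : Λ ≃ Λ) (A : Op Λ q) :
    permOp e * A * (permOp e)ᴴ = reindexOp e A := by
  rw [permOp_mul, mul_conjTranspose_permOp]
  ext σ τ
  rw [reindexOp_apply, submatrix_apply, submatrix_apply, id, id, configPerm_apply, configPerm_apply]

/-- `permOp e * (permOp e)ᴴ = 1`. [folklore] -/
theorem permOp_mul_conjTranspose (e : Λ ≃ Λ) : (permOp e : Op Λ q) * (permOp e)ᴴ = 1 := by
  have h := permOp_mul_mul_conjTranspose e (1 : Op Λ q)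
  rwa [mul_one, map_one] at h

/-- `(permOp e)ᴴ * permOp e = 1`. [folklore] -/
theorem conjTranspose_permOp_mul (e : Λ ≃ Λ) : (permOp e : Op Λ q)ᴴ * permOp e = 1 := by
  have h := permOp_mul_conjTranspose (q := q) e.symm
  rwa [conjTranspose_permOp, Equiv.symm_symm, ← conjTranspose_permOp] at h

/-- `permOp e` is unitary. [folklore] -/
theorem permOp_mem_unitaryGroup (e : Λ ≃ Λ) : (permOp e : Op Λ q) ∈ Matrix.unitaryGroup (TensorIndex Λ q) ℂ :=
  ⟨by rw [star_eq_conjTranspose, conjTranspose_permOp_mul], by rw [star_eq_conjTranspose, permOp_mul_conjTranspose]⟩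

/-- `permOp e` commutes with `A` iff `A` is invariant under the relabelling `e`. [folklore] -/
theorem permOp_mul_eq_mul_permOp_iff (e : Λ ≃ Λ) (A : Op Λ q) :
    permOp e * A = A * permOp e ↔ reindexOp e A = A := by
  rw [← permOp_mul_mul_conjTranspose]
  constructor
  · intro h
    rw [h, mul_assoc, permOp_mul_conjTranspose, mul_one]
  · intro h
    have h2 := congrArg (fun M => M * permOp e) h
    rw [mul_assoc, conjTranspose_permOp_mul, mul_one] at h2
    exact h2

/-! #### Covariance of the local algebras -/

/-- **Relabelling a local operator**: `reindexOp e (A ⊗ 𝟙_{Λ∖X}) = A' ⊗ 𝟙_{Λ∖e(X)}` with `A'` the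
matrix `A` transported along `X ≃ e(X)`. Bratteli–Robinson II §6.2.1 (covariance). [folklore] -/
theorem reindexOp_localOp (e : Λ ≃ Λ) (X : Finset Λ) (B : Matrix (X → Fin q) (X → Fin q) ℂ) :
    reindexOp e (localOp X B) = localOp (X.map e.toEmbedding)
      (Matrix.of fun α β : (↥(X.map e.toEmbedding) → Fin q) =>
        B (fun x => α ⟨e x, Finset.mem_map_of_mem _ x.2⟩)
          (fun x => β ⟨e x, Finset.mem_map_of_mem _ x.2⟩)) := by
  ext σ τ
  rw [reindexOp_apply, localOp_apply, localOp_apply, of_apply]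
  have hcond : (∀ y, y ∉ X → (fun x => σ (e x)) y = (fun x => τ (e x)) y) ↔
      ∀ y', y' ∉ X.map e.toEmbedding → σ y' = τ y' := by
    constructor
    · intro h y' hy'
      have h1 := h (e.symm y') fun hmem => hy' (Finset.mem_map.2 ⟨e.symm y', hmem, by simp⟩)
      simpa using h1
    · intro h y hy
      exact h (e y) fun hmem => by
        obtain ⟨z, hz, hze⟩ := Finset.mem_map.1 hmem
        exact hy (by rwa [← e.injective (show e z = e y from hze)])
  rw [if_congr hcond rfl rfl]

/-- **Covariance of the local algebras**: `A ∈ 𝔄_X ⟹ reindexOp e A ∈ 𝔄_{e(X)}`. BBDF (2019)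
§2.2 (i) (`U⋆ 𝒜_X U ⊆ 𝒜_{X^{(r)}}`, here with `r = 0`); Bratteli–Robinson II §6.2.1. [folklore] -/
theorem reindexOp_mem_supportedSubalgebra (e : Λ ≃ Λ) {X : Finset Λ} {A : Op Λ q}
    (hA : A ∈ supportedSubalgebra X) : reindexOp e A ∈ supportedSubalgebra (X.map e.toEmbedding) := by
  obtain ⟨B, rfl⟩ := hA
  rw [reindexOp_localOp]
  exact isSupportedOn_localOp _ _

/-- Conjugating an element of `𝔄_X` by the permutation unitary lands in `𝔄_{e(X)}`. [folklore] -/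
theorem permOp_conj_mem_supportedSubalgebra (e : Λ ≃ Λ) {X : Finset Λ} {A : Op Λ q}
    (hA : A ∈ supportedSubalgebra X) :
    permOp e * A * (permOp e)ᴴ ∈ supportedSubalgebra (X.map e.toEmbedding) := by
  rw [permOp_mul_mul_conjTranspose]
  exact reindexOp_mem_supportedSubalgebra e hA

/-- Conjugation of a single-site operator: `permOp e · (𝟙⊗a_x⊗𝟙) · (permOp e)ᴴ = 𝟙⊗a_{e x}⊗𝟙`.
Tasaki (2020) §2.2, eq. (2.2.5). [folklore] -/
theorem permOp_mul_onSite_mul_conjTranspose (e : Λ ≃ Λ) (x : Λ) (a : Matrix (Fin q) (Fin q) ℂ) :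
    permOp e * (onSite x a : Op Λ q) * (permOp e)ᴴ = onSite (e x) a := by
  rw [permOp_mul_mul_conjTranspose, reindexOp_onSite]

end Perm

/-! ### The integer charges of a spin-`1/2` system -/

section Charges

variable {Λ : Type*} [Fintype Λ] [DecidableEq Λ]

/-- **The site charge `Q_x = Sᶻ_x + ½`** of a spin-`1/2` system (the projection onto "spin up" at
`x`; spectrum `{0, 1} ⊆ ℤ`, as required of the charges in BBDF (2019) §2.1.4).
[cite: BachmannEtAl2019, §2.1.4] -/
def upCharge (x : Λ) : Op Λ 2 := siteSpin 1 x 2 + (1 / 2 : ℂ) • 1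

/-- **The charge `Q_X = Σ_{x ∈ X} Q_x` of a region.** BBDF (2019) §2.1.4. [cite: BachmannEtAl2019, §2.1.4] -/
def regionCharge (X : Finset Λ) : Op Λ 2 := ∑ x ∈ X, upCharge x

/-- The number of up spins (`σ_x = 0`) of the configuration `σ` in the region `X`. [folklore] -/
def upSpinCount (X : Finset Λ) (σ : TensorIndex Λ 2) : ℕ := (X.filter fun x => σ x = 0).card

/-- The up-spin projection `diag(1, 0) = Sᶻ + ½` on `ℂ²`. [folklore] -/
theorem spinZ_one_add_half :
    SpinOperators.spinZ 1 + (1 / 2 : ℂ) • (1 : Matrix (Fin 2) (Fin 2) ℂ) =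
      diagonal fun k : Fin 2 => if k = 0 then 1 else 0 := by
  rw [SpinOperators.spinZ, smul_eq_diagonal_mul, Matrix.mul_one, diagonal_add]
  congr 1
  funext k
  fin_cases k <;> simp <;> norm_num

/-- `Q_x` is the single-site operator `diag(1,0)` at `x`. [folklore] -/
theorem siteCharge_eq_onSite (x : Λ) :
    upCharge x = onSite x (diagonal fun k : Fin 2 => if k = 0 then (1:ℂ) else 0) := by
  rw [upCharge, siteSpin, spinVec_two, ← spinZ_one_add_half, onSite_add', onSite_smul', onSite_one']

/-- `Q_x` is diagonal in the product basis: entry `[σ_x = ↑]`. [folklore] -/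
theorem siteCharge_eq_diagonal (x : Λ) :
    upCharge x = diagonal fun σ : TensorIndex Λ 2 => if σ x = 0 then (1:ℂ) else 0 := by
  rw [siteCharge_eq_onSite, LiebMattis.onSite_diagonal]

/-- **`Q_X` is diagonal in the product basis with natural-number entries** `#{x ∈ X : σ_x = ↑}`.
BBDF (2019) §2.1.4 (integer spectrum). [folklore] -/
theorem regionCharge_eq_diagonal (X : Finset Λ) :
    regionCharge X = diagonal fun σ : TensorIndex Λ 2 => (upSpinCount X σ : ℂ) := by
  ext σ τ
  rw [regionCharge, Matrix.sum_apply, diagonal_apply]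
  simp only [siteCharge_eq_diagonal, diagonal_apply]
  by_cases h : σ = τ
  · subst h
    simp only [if_true]
    rw [upSpinCount, Finset.natCast_card_filter]
  · simp [h]

/-- `Q_X` is Hermitian. [folklore] -/
theorem regionCharge_isHermitian (X : Finset Λ) : (regionCharge X).IsHermitian := by
  rw [regionCharge_eq_diagonal]
  exact isHermitian_diagonal_iff.2 fun σ => by simp [isSelfAdjoint_iff]

/-- `Q_x` is Hermitian. [folklore] -/
theorem siteCharge_isHermitian (x : Λ) : (upCharge x).IsHermitian := by
  have h := regionCharge_isHermitian ({x} : Finset Λ)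
  rwa [regionCharge, Finset.sum_singleton] at h

/-- Charges of regions commute. [folklore] -/
theorem commute_regionCharge (X Y : Finset Λ) : Commute (regionCharge X) (regionCharge Y) := by
  rw [regionCharge_eq_diagonal, regionCharge_eq_diagonal, Commute, SemiconjBy, diagonal_mul_diagonal,
    diagonal_mul_diagonal]
  congr 1
  funext σ
  ring

/-- Additivity over disjoint regions: `Q_{X ∪ Y} = Q_X + Q_Y`. [folklore] -/
theorem regionCharge_union {X Y : Finset Λ} (h : Disjoint X Y) :
    regionCharge (X ∪ Y) = regionCharge X + regionCharge Y := by
  rw [regionCharge, regionCharge, regionCharge, Finset.sum_union h]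

/-- `Q_∅ = 0`. [folklore] -/
@[simp] theorem regionCharge_empty : regionCharge (∅ : Finset Λ) = 0 := by simp [regionCharge]

/-- `Q_{\{x\}} = Q_x`. [folklore] -/
theorem regionCharge_singleton (x : Λ) : regionCharge ({x} : Finset Λ) = upCharge x := by
  rw [regionCharge, Finset.sum_singleton]

/-- `Q_X ∈ 𝔄_X`. [folklore] -/
theorem regionCharge_mem_supportedSubalgebra (X : Finset Λ) : regionCharge X ∈ supportedSubalgebra X := by
  refine Subalgebra.sum_mem _ fun x hx => ?_
  rw [siteCharge_eq_onSite]
  exact onSite_mem_supportedSubalgebra hx _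

/-- `Q_X ∈ 𝔄_Y` for `X ⊆ Y`. [folklore] -/
theorem regionCharge_mem_supportedSubalgebra_of_subset {X Y : Finset Λ} (h : X ⊆ Y) :
    regionCharge X ∈ supportedSubalgebra Y :=
  supportedSubalgebra_mono h (regionCharge_mem_supportedSubalgebra X)

/-- **Norm bound** `‖Q_X‖ ≤ #X` (diagonal with entries in `{0, …, #X}`). [folklore] -/
theorem norm_regionCharge_le (X : Finset Λ) : ‖regionCharge X‖ ≤ X.card := by
  rw [regionCharge_eq_diagonal, l2_opNorm_diagonal, pi_norm_le_iff_of_nonneg (Nat.cast_nonneg _)]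
  intro σ
  rw [Complex.norm_natCast]
  exact_mod_cast Finset.card_filter_le X _

/-- `Q_x` is a projection: `Q_x² = Q_x`. [folklore] -/
theorem siteCharge_mul_self (x : Λ) : upCharge x * upCharge x = upCharge x := by
  rw [siteCharge_eq_onSite, onSite_mul]
  congr 1
  rw [diagonal_mul_diagonal]
  congr 1
  funext k
  split_ifs <;> simp

/-- **Integrality of the charges**: `e^{2πi Q_X} = 1`. BBDF (2019) §2.1.4 (`Spec(Q_x) ⊆ ℤ`).
[cite: BachmannEtAl2019, §2.1.4] -/
theorem exp_two_pi_I_smul_regionCharge (X : Finset Λ) :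
    NormedSpace.exp ((2 * Real.pi * I) • regionCharge X) = 1 := by
  classical
  induction X using Finset.induction_on with
  | empty => simp [NormedSpace.exp_zero]
  | insert x X hx ih =>
    have hsplit : regionCharge (insert x X) = regionCharge {x} + regionCharge X := by
      rw [regionCharge, Finset.sum_insert hx, regionCharge_singleton, regionCharge]
    have hcomm : Commute ((2 * Real.pi * I) • regionCharge ({x} : Finset Λ))
        ((2 * Real.pi * I) • regionCharge X) :=
      ((commute_regionCharge {x} X).smul_left _).smul_right _
    rw [hsplit, smul_add, Matrix.exp_add_of_commute _ _ hcomm, ih, Matrix.mul_one,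
      regionCharge_singleton, exp_two_pi_I_smul_of_mul_self_eq (siteCharge_mul_self x)]

/-- **Covariance of the charges**: `reindexOp e (Q_X) = Q_{e(X)}`. BBDF (2019) §3.2. [folklore] -/
theorem reindexOp_regionCharge (e : Λ ≃ Λ) (X : Finset Λ) :
    reindexOp e (regionCharge X) = regionCharge (X.map e.toEmbedding) := by
  rw [regionCharge, regionCharge, map_sum, Finset.sum_map]
  refine Finset.sum_congr rfl fun x _ => ?_
  rw [siteCharge_eq_onSite, siteCharge_eq_onSite, reindexOp_onSite]
  rfl

/-- `permOp e · Q_X · (permOp e)ᴴ = Q_{e(X)}`. BBDF (2019) §3.2 (`U⋆ Q_X U`). [folklore] -/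
theorem permOp_mul_regionCharge_mul_conjTranspose (e : Λ ≃ Λ) (X : Finset Λ) :
    permOp e * regionCharge X * (permOp e)ᴴ = regionCharge (X.map e.toEmbedding) := by
  rw [permOp_mul_mul_conjTranspose, reindexOp_regionCharge]

/-- **`Q_X = Sᶻ_X + #X/2`**: the region charge is the `z`-magnetisation of the region shifted by
half its size. [folklore] -/
theorem regionCharge_eq_sum_siteSpin_add (X : Finset Λ) :
    regionCharge X = ∑ x ∈ X, (siteSpin 1 x 2 : Op Λ 2) + ((X.card : ℂ) / 2) • (1 : Op Λ 2) := by
  unfold regionCharge upCharge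
  rw [Finset.sum_add_distrib, Finset.sum_const, ← Nat.cast_smul_eq_nsmul ℂ, smul_smul]
  congr 2
  ring

end Charges

/-! ### Symmetric unique ground states -/

section GroundState

variable {Λ : Type*} [Fintype Λ] [DecidableEq Λ] {q : ℕ}

/-- `‖permOp e ψ‖² = ‖ψ‖²` (unitarity). [folklore] -/
theorem star_permOp_mulVec_dotProduct (e : Λ ≃ Λ) (ψ : TensorIndex Λ q → ℂ) :
    star (permOp e *ᵥ ψ) ⬝ᵥ (permOp e *ᵥ ψ) = star ψ ⬝ᵥ ψ := by
  rw [star_mulVec, ← dotProduct_mulVec, mulVec_mulVec, conjTranspose_permOp_mul, one_mulVec]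

/-- **A unique gapped ground state is an eigenvector of every symmetry relabelling**: if
`permOp e` commutes with `H` (`H` Hermitian with a unique gapped ground state `ψ`), then
`permOp e ψ = λψ` with `|λ| = 1` and `(permOp e)ᴴ ψ = λ⁻¹ ψ`. BBDF (2019) Assumption (iii) for an
exact symmetry (§3.2: the ground state is an eigenvector of the translation). [folklore] -/
theorem exists_permOp_mulVec_eq_smul {H : Op Λ q} {g : ℝ} (hgap : H.HasSpectralGap g) (e : Λ ≃ Λ)
    (hsym : permOp e * H = H * permOp e) {ψ : TensorIndex Λ q → ℂ} (hψ : H.IsGroundStateVector ψ) :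
    ∃ lam : ℂ, ‖lam‖ = 1 ∧ permOp e *ᵥ ψ = lam • ψ ∧ (permOp e)ᴴ *ᵥ ψ = lam⁻¹ • ψ := by
  obtain ⟨c, hc⟩ := hgap.exists_mulVec_eq_smul hsym hψ
  have hψ0 : ψ ≠ 0 := hψ.1
  have hnorm := star_permOp_mulVec_dotProduct e ψ
  rw [hc, star_smul, smul_dotProduct, dotProduct_smul, smul_smul, smul_eq_mul] at hnorm
  have hψψ : star ψ ⬝ᵥ ψ ≠ 0 := by
    rw [star_dotProduct_self_eq_eucNorm_sq]
    have : eucNorm ψ ≠ 0 := by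
      intro h0
      apply hψ0
      have : (WithLp.toLp 2 ψ : EuclideanSpace ℂ (TensorIndex Λ q)) = 0 := norm_eq_zero.1 h0
      exact (WithLp.toLp_eq_zero (p := 2)).1 this
    exact_mod_cast pow_ne_zero 2 this
  have hcc : starRingEnd ℂ c * c = 1 := by
    have h := mul_right_cancel₀ hψψ (hnorm.trans (one_mul _).symm)
    simpa using h
  have hcnorm : ‖c‖ = 1 := by
    have h := congrArg (fun z : ℂ => ‖z‖) hcc
    simp only [norm_mul, Complex.norm_conj, norm_one] at h
    nlinarith [norm_nonneg c]
  have hc0 : c ≠ 0 := fun h0 => by rw [h0, norm_zero] at hcnorm; exact zero_ne_one hcnorm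
  refine ⟨c, hcnorm, hc, ?_⟩
  have h := congrArg (fun v => (permOp e)ᴴ *ᵥ v) hc
  simp only [mulVec_mulVec, conjTranspose_permOp_mul, one_mulVec, mulVec_smul] at h
  have h2 := congrArg (fun v => c⁻¹ • v) h
  simp only [smul_smul, inv_mul_cancel₀ hc0, one_smul] at h2
  exact h2.symm

/-- **Translation invariance of the ground-state expectations**, both ways:
`⟨ψ, P X Pᴴ ψ⟩ = ⟨ψ, X ψ⟩ = ⟨ψ, Pᴴ X P ψ⟩` for `P = permOp e` a symmetry of `H`. BBDF (2019) §3.2.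
[folklore] -/
theorem expect_permOp_conj {H : Op Λ q} {g : ℝ} (hgap : H.HasSpectralGap g) (e : Λ ≃ Λ)
    (hsym : permOp e * H = H * permOp e) {ψ : TensorIndex Λ q → ℂ} (hψ : H.IsGroundStateVector ψ)
    (X : Op Λ q) :
    star ψ ⬝ᵥ ((permOp e * X * (permOp e)ᴴ) *ᵥ ψ) = star ψ ⬝ᵥ (X *ᵥ ψ) ∧
      star ψ ⬝ᵥ (((permOp e)ᴴ * X * permOp e) *ᵥ ψ) = star ψ ⬝ᵥ (X *ᵥ ψ) := by
  obtain ⟨lam, hlam, hV, hVh⟩ := exists_permOp_mulVec_eq_smul hgap e hsym hψ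
  constructor
  · have h := expect_conjTranspose_mul_mul (U := (permOp e)ᴴ) (X := X) hVh (by rw [norm_inv, hlam, inv_one])
    rwa [conjTranspose_conjTranspose] at h
  · exact expect_conjTranspose_mul_mul (U := permOp e) (X := X) hV hlam

/-- **`SU(2)` invariance forces `Sᶻ_tot ψ = 0` on a unique ground state**: if `H` commutes with the
three components of the total spin and `dim ker(H - E₀) = 1`, then every ground-state vector is
annihilated by `Sᶻ_tot` (a one-dimensional invariant subspace carries `Ŝ^α_tot ψ = c_α ψ`, and
`i Ŝᶻ_tot ψ = [Ŝˣ_tot, Ŝʸ_tot] ψ = 0`). Tasaki (2020) §2.2–2.3; Nachtergaele–Sims (2007) condition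
LSM5 (the ground state has eigenvalue `1` for the rotations about the `z`-axis). [folklore] -/
theorem totalSpin_two_mulVec_eq_zero_of_hasUniqueGroundState {n : ℕ} {H : Op Λ (n + 1)}
    (hc : ∀ α, Commute H (totalSpin (Λ := Λ) n α)) (hu : H.HasUniqueGroundState)
    {ψ : TensorIndex Λ (n + 1) → ℂ} (hψ : ψ ∈ H.groundSpace) :
    (totalSpin (Λ := Λ) n 2) *ᵥ ψ = 0 := by
  have h1 : Module.finrank ℂ H.groundSpace = 1 := hu
  have hmem : ∀ α, (totalSpin (Λ := Λ) n α) *ᵥ ψ ∈ H.groundSpace := fun α =>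
    mulVec_mem_groundSpace_of_commute (hc α).symm.eq hψ
  by_cases hψ0 : ψ = 0
  · rw [hψ0, mulVec_zero]
  have hv : (⟨ψ, hψ⟩ : H.groundSpace) ≠ 0 := fun h0 => hψ0 (congrArg Subtype.val h0)
  have heig : ∀ α, ∃ c : ℂ, (totalSpin (Λ := Λ) n α) *ᵥ ψ = c • ψ := fun α => by
    obtain ⟨c, hc'⟩ := (finrank_eq_one_iff_of_nonzero' _ hv).1 h1 ⟨_, hmem α⟩
    exact ⟨c, (congrArg Subtype.val hc').symm⟩
  obtain ⟨a, ha⟩ := heig 0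
  obtain ⟨b, hb⟩ := heig 1
  have hxy : (totalSpin n 0 * totalSpin n 1 - totalSpin n 1 * totalSpin n 0 : Op Λ (n + 1)) *ᵥ ψ = 0 := by
    rw [Matrix.sub_mulVec, ← Matrix.mulVec_mulVec, ← Matrix.mulVec_mulVec, hb, ha,
      Matrix.mulVec_smul, Matrix.mulVec_smul, ha, hb, smul_smul, smul_smul, mul_comm a b, sub_self]
  rw [LiebMattis.totalSpin_zero_commutator_one, Matrix.smul_mulVec] at hxy
  exact (smul_eq_zero.1 hxy).resolve_left I_ne_zero

/-- **The total charge of an `SU(2)`-symmetric unique ground state is `|Λ|/2`**: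
`⟨ψ, Q_Λ ψ⟩ = (|Λ|/2) ⟨ψ, ψ⟩` (spin `1/2`). BBDF (2019) §3.2 with `Q_x = Sᶻ_x + ½`. [folklore] -/
theorem expect_regionCharge_univ_of_hasUniqueGroundState {H : Op Λ 2}
    (hc : ∀ α, Commute H (totalSpin (Λ := Λ) 1 α)) (hu : H.HasUniqueGroundState)
    {ψ : TensorIndex Λ 2 → ℂ} (hψ : ψ ∈ H.groundSpace) :
    star ψ ⬝ᵥ (regionCharge (Finset.univ : Finset Λ) *ᵥ ψ) =
      ((Fintype.card Λ : ℂ) / 2) * (star ψ ⬝ᵥ ψ) := by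
  rw [regionCharge_eq_sum_siteSpin_add, add_mulVec, smul_mulVec, one_mulVec, dotProduct_add,
    dotProduct_smul, smul_eq_mul, Finset.card_univ]
  have h0 : (∑ x ∈ (Finset.univ : Finset Λ), (siteSpin 1 x 2 : Op Λ 2)) *ᵥ ψ = 0 :=
    totalSpin_two_mulVec_eq_zero_of_hasUniqueGroundState hc hu hψ
  rw [h0, dotProduct_zero, zero_add]

end GroundState

end Literature.MathematicalPhysics.QuantumLattice

end
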